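import Summits.QuantumFields.YangMills.Theorems.BalabanUVNodesN15KingModelGraphPowerCountingSubgraphsKing
import Mathlib.Order.Interval.Finset.Fin

/-!
# BalabanUVNodes ∕ N15 — THE KING-MODEL RUNG (PART Δ-f): **THE CONVERSE — KING's (3.77) ALONG EVERY ORDERING AND «EVERY SUBGRAPH HAS POSITIVE DEGREE» ARE
# EQUIVALENT**: a connected non-empty sub-line-set `S`, listed FIRST in an ordering, is shrunk to ONE point after `|S|` steps and `D(H_{|S|}) = D(S)`; so the
# positivity of King's degrees along every ordering gives back the subgraph condition, with the same margin — part Δ-b's hypothesis costs nothing against part Γ-l's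
# (Track A, DAG node N15 = NE2; FAN-OUT v1.1 §N15 s3 «KING-MODEL RUNG … NE2's analogue DECIDED in the model»)

HONEST FRAMING.  Count-neutral (cell `pub-ymgap`, seat `pub-ymgap-dag-n15-e` g28; `--supports stmt-QuantumFields-27366 --as helper` = K3⁸
`SpineGivenEndpointR13SepCoPHV`).  TEMPLATE LITERATURE: C. King, *The U(1) Higgs model. I. The continuum limit*, Commun. Math. Phys. **102** (1986) 649–677
[King1986], §3.4 p. 664, §3.5 (3.77) p. 666.  Part Δ-b ★★★ `posDegreesBy_kingDegList_of_posSubgraphsBy`: the ORDERING-FREE subgraph condition `PosSubgraphsBy γ₁`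
(`γ₁ ≥ 0`) gives `PosDegreesBy γ₁ (kingDegList … π)` along EVERY ordering `π`.  THIS FILE proves the converse (any `γ₁`): choose an ordering that lists the lines
of a connected non-empty `S` first (a `Tuple.sort` of the indicator of `Sᶜ`); after `|S|` steps the subgraph `H_{|S|}` IS `S`, shrunk to one Kruskal point (part
Δ-a), so `D(H_{|S|}) = D(S)` and positivity along that ordering gives `D(S) > γ₁`.  Hence the EQUIVALENCE of King's two sentences — p.664 «every subgraph has
positive degree» and (3.77) «D(H_i) > 0» for every ordering — in the typed currency.  Finite combinatorics; King's U(1)∕`A = 0` model bookkeeping; NOT Bałaban's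
`G(U)`; NOT a node discharge; nothing continuum ∕ ℝ⁴ ∕ OS ∕ mass-gap ∕ Clay.  0 `sorry`; standard axioms.
THE PRINT.  p. 664 [PDF 16]: *«it is necessary that every subgraph have positive degree D … renormalised graphs, in which every subgraph has positive degree»*;
p. 666 [PDF 18]: *«(i) D(H_i) > 0 for 1 ≤ i ≤ m₁ (3.77)»*.
WHAT THIS FILE PROVES.
* §1 (ns `…Graph`): `memKey S` (indicator of `Sᶜ`), `prefixPerm S` (`Tuple.sort` of the key: an ordering listing `S` first), `memKey_prefixPerm_mono`,
  ★ `prefixPerm_apply_mem` (`q < |S| ⇒ π q ∈ S`), ★ `lt_card_of_prefixPerm_apply_mem` (`π q ∈ S ⇒ q < |S|`), ★ `prefixLines_prefixPerm` (`prefixLines π |S| = S`).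
* §2 (ns `…Graph`): `klab_eq_of_lConn_prefixLines`, `labelLines_eq_self`, ★★ **`prefixDeg_eq_subDeg_of_connected`** (connected non-empty `S` listed first:
  `D(H_{|S|}) = D(S)`).
* §3 (ns `…Curved`): converse list letters `posDegreesBy_ofFn_imp`, `posDegreesBy_ofFn_rev_imp_prefix`, `posDegreesBy_zero_iff`.
* §4 ★★ **`posSubgraphsBy_of_forall_posDegreesBy`** (`∀ π, PosDegreesBy γ₁ (kingDegList src tgt dV e π)` ⇒ `PosSubgraphsBy src tgt γ₁ dV e`, any `γ₁`),
  ★★★ **`posSubgraphsBy_iff_forall_posDegreesBy`** (`0 ≤ γ₁`: EQUIVALENCE), ★★ `posSubgraphs_zero_iff_forall_posDegrees` (King's letters: the p.664 sentence ⟺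
  (3.77) VERBATIM along every ordering).
HONEST SCOPE.  Bookkeeping only; which graphs satisfy either sentence (§3.5, [Ba3]) is not touched.  Locators: [King1986] p.664, (3.66) p.663 (foot), (3.77) p.666.
-/
noncomputable section

namespace Summit.QuantumFields.YangMills.BalabanUVNodes.N15KingModelRung.Graph

open scoped BigOperators
open Finset

/-! ## §1 An ordering that lists the lines of `S` first -/

section PrefixPerm
variable {m : ℕ}

/-- the indicator key: `0` on `S`, `1` off `S`. [folklore] -/
def memKey (S : Finset (Fin m)) (ℓ : Fin m) : ℕ := if ℓ ∈ S then 0 else 1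

/-- **AN ORDERING LISTING THE LINES OF `S` FIRST**: sort the lines by the indicator key. [folklore] -/
def prefixPerm (S : Finset (Fin m)) : Equiv.Perm (Fin m) := Tuple.sort (memKey S)

/-- along `prefixPerm S` the key is monotone: lines of `S` come first. [folklore] -/
theorem memKey_prefixPerm_mono (S : Finset (Fin m)) : Monotone (memKey S ∘ prefixPerm S) := Tuple.monotone_sort _

/-- ★ **THE FIRST `|S|` LINES OF THE ORDERING LIE IN `S`.** [folklore] -/
theorem prefixPerm_apply_mem (S : Finset (Fin m)) {q : Fin m} (hq : ((q : ℕ)) < S.card) : prefixPerm S q ∈ S := by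
  classical
  by_contra hqS
  -- every later position is also off `S`; so the positions hitting `S` lie below `q`
  have hsub : (univ : Finset (Fin m)).filter (fun q' : Fin m => prefixPerm S q' ∈ S) ⊆ Iio q := by
    intro q' hq'
    rw [mem_filter] at hq'
    rw [mem_Iio]
    by_contra hle
    have hmono := memKey_prefixPerm_mono S (not_lt.1 hle)
    simp only [Function.comp, memKey, if_neg hqS, if_pos hq'.2] at hmono
    exact absurd hmono (by norm_num)
  have hcard : ((univ : Finset (Fin m)).filter fun q' : Fin m => prefixPerm S q' ∈ S).card = S.card := by
    have himg : ((univ : Finset (Fin m)).filter fun q' : Fin m => prefixPerm S q' ∈ S) = S.image (prefixPerm S).symm := by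
      ext q'
      simp only [mem_filter, mem_univ, true_and, mem_image]
      constructor
      · intro h; exact ⟨_, h, (prefixPerm S).symm_apply_apply q'⟩
      · rintro ⟨ℓ, hℓ, rfl⟩; rwa [Equiv.apply_symm_apply]
    rw [himg, card_image_of_injective _ (prefixPerm S).symm.injective]
  have h := card_le_card hsub
  rw [hcard, Fin.card_Iio] at h
  omega

/-- ★ **A LINE OF `S` SITS AT A POSITION `< |S|`.** [folklore] -/
theorem lt_card_of_prefixPerm_apply_mem (S : Finset (Fin m)) {q : Fin m} (hq : prefixPerm S q ∈ S) : ((q : ℕ)) < S.card := by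
  classical
  by_contra hge
  -- every earlier position is also in `S`; so `S` has at least `q + 1 > |S|` lines
  have hsub : (Iic q).image (prefixPerm S) ⊆ S := by
    intro ℓ hℓ
    obtain ⟨q', hq', rfl⟩ := mem_image.1 hℓ
    rw [mem_Iic] at hq'
    have hmono := memKey_prefixPerm_mono S hq'
    by_contra hq'S
    simp only [Function.comp, memKey, if_neg hq'S, if_pos hq] at hmono
    exact absurd hmono (by norm_num)
  have h := card_le_card hsub
  rw [card_image_of_injective _ (prefixPerm S).injective, Fin.card_Iic] at h
  omega

/-- ★ **`H_{|S|}` IS `S`**: the first `|S|` lines of `prefixPerm S` are exactly the lines of `S`. [cite: King1986, (3.66) p.663] -/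
theorem prefixLines_prefixPerm (S : Finset (Fin m)) : prefixLines (prefixPerm S) S.card = S := by
  ext ℓ
  rw [mem_prefixLines]
  constructor
  · intro h
    have := prefixPerm_apply_mem S h
    rwa [Equiv.apply_symm_apply] at this
  · intro h
    exact lt_card_of_prefixPerm_apply_mem S (by rwa [Equiv.apply_symm_apply])

end PrefixPerm

/-! ## §2 A connected line set listed first is shrunk to one point: `D(H_{|S|}) = D(S)` -/

section OnePoint
variable {nn m : ℕ} {src tgt : Fin m → Fin (nn + 1)}

/-- two vertices joined through the lines of `H_i` carry the same label after `i` steps. [cite: King1986, p.664] -/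
theorem klab_eq_of_lConn_prefixLines {π : Equiv.Perm (Fin m)} {i : ℕ} {u v : Fin (nn + 1)} (h : LConn src tgt (prefixLines π i) u v) :
    klab src tgt π i u = klab src tgt π i v :=
  (lConn_labelLines_of_lConn h).1

/-- if all lines of `H_i` lie in one point `c`, that point's line set is all of `H_i`. [cite: King1986, p.664] -/
theorem labelLines_eq_self {π : Equiv.Perm (Fin m)} {i : ℕ} {c : Fin (nn + 1)} (h : ∀ ℓ ∈ prefixLines π i, klab src tgt π i (src ℓ) = c) :
    labelLines src tgt π i c = prefixLines π i := by
  unfold labelLines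
  exact filter_true_of_mem h

/-- ★★ **A CONNECTED NON-EMPTY LINE SET LISTED FIRST IS ONE POINT AFTER `|S|` STEPS, AND `D(H_{|S|}) = D(S)`**: with `prefixLines π |S| = S` and `S` connected, all
vertices of `S` carry one label, the points of `H_{|S|}` are that single point, its line set is `S`, and part Δ-a's `D(H_i) = Σ_points D(S_point)` has one term.
[cite: King1986, (3.66) p.663, p.664 («eventually shrinking H to one point»)] -/
theorem prefixDeg_eq_subDeg_of_connected (dV : ℝ) (e : Fin m → ℝ) {π : Equiv.Perm (Fin m)} {S : Finset (Fin m)} (hπ : prefixLines π S.card = S)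
    (hS : S.Nonempty) (hc : ∀ u ∈ lineVerts src tgt S, ∀ v ∈ lineVerts src tgt S, LConn src tgt S u v) :
    prefixDeg src tgt dV e π S.card = subDeg src tgt dV e S := by
  classical
  obtain ⟨ℓ₀, hℓ₀⟩ := hS
  set c := klab src tgt π S.card (src ℓ₀) with hc_def
  -- every vertex of `S` carries the label `c`
  have hlab : ∀ v ∈ lineVerts src tgt S, klab src tgt π S.card v = c := by
    intro v hv
    have h := hc v hv (src ℓ₀) (src_mem_lineVerts hℓ₀)
    rw [← hπ] at h
    exact klab_eq_of_lConn_prefixLines h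
  -- the points of `H_{|S|}`: the single point `c`
  have hpts : (lineVerts src tgt (prefixLines π S.card)).image (klab src tgt π S.card) = {c} := by
    rw [hπ]
    ext c'
    simp only [mem_image, mem_singleton]
    constructor
    · rintro ⟨v, hv, rfl⟩; exact hlab v hv
    · rintro rfl; exact ⟨src ℓ₀, src_mem_lineVerts hℓ₀, rfl⟩
  -- its line set is `S`
  have hlines : labelLines src tgt π S.card c = S := by
    rw [labelLines_eq_self (fun ℓ hℓ => hlab (src ℓ) (by rw [← hπ]; exact src_mem_lineVerts hℓ)), hπ]
  rw [prefixDeg_eq_sum_subDeg, hpts, sum_singleton, hlines]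

end OnePoint

end Summit.QuantumFields.YangMills.BalabanUVNodes.N15KingModelRung.Graph

namespace Summit.QuantumFields.YangMills.BalabanUVNodes.N15KingModelRung.Curved

open scoped BigOperators
open Finset
open Summit.QuantumFields.YangMills.BalabanUVNodes.N15KingModelRung.Graph

variable (L : ℕ)

/-! ## §3 Converse list letters -/

section Lists

omit L in
/-- `PosDegreesBy δ (List.ofFn h)` gives every suffix sum `> δ`. [cite: King1986, (3.66) p.664, (3.77) p.666] -/
theorem posDegreesBy_ofFn_imp (δ : ℝ) :
    ∀ {n : ℕ} (h : Fin n → ℝ), PosDegreesBy δ (List.ofFn h) → ∀ p : Fin n, δ < ∑ q ∈ (univ : Finset (Fin n)).filter (fun q : Fin n => p ≤ q), h q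
  | 0, _, _, p => Fin.elim0 p
  | n + 1, h, H, p => by
      rw [List.ofFn_succ] at H
      obtain ⟨h1, h2⟩ := H
      refine Fin.cases ?_ (fun p' => ?_) p
      · -- the total
        have hall : (univ : Finset (Fin (n + 1))).filter (fun q : Fin (n + 1) => (0 : Fin (n + 1)) ≤ q) = univ :=
          filter_true_of_mem fun q _ => Fin.zero_le q
        rw [hall, Fin.sum_univ_succ, ← List.sum_ofFn]
        exact h1
      · -- a proper suffix
        have hp := posDegreesBy_ofFn_imp δ (fun i : Fin n => h i.succ) h2 p'
        rw [sum_filter, Fin.sum_univ_succ, if_neg (not_le.2 (Fin.succ_pos p')), zero_add]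
        rw [sum_filter] at hp
        refine lt_of_lt_of_eq hp (sum_congr rfl fun i _ => ?_)
        simp only [Fin.succ_le_succ_iff]

omit L in
/-- the prefix form for the reversed list: `PosDegreesBy δ (List.ofFn (g ∘ Fin.rev))` gives `δ < Σ_{q<i} g q` for every `1 ≤ i ≤ m`.
[cite: King1986, (3.66) p.664, (3.77) p.666] -/
theorem posDegreesBy_ofFn_rev_imp_prefix (δ : ℝ) {m : ℕ} (g : Fin m → ℝ) (H : PosDegreesBy δ (List.ofFn fun p : Fin m => g (Fin.rev p)))
    {i : ℕ} (hi : 1 ≤ i) (him : i ≤ m) : δ < ∑ q ∈ (univ : Finset (Fin m)).filter (fun q : Fin m => ((q : ℕ)) < i), g q := by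
  have hp : m - i < m := by omega
  have h := posDegreesBy_ofFn_imp δ (fun p : Fin m => g (Fin.rev p)) H ⟨m - i, hp⟩
  rw [sum_filter_le_comp_rev g ⟨m - i, hp⟩] at h
  have hmi : m - (m - i) = i := by omega
  simp only [hmi] at h
  exact h

omit L in
/-- margin `0` is plain positivity. [folklore] -/
theorem posDegreesBy_zero_iff : ∀ {es : List ℝ}, PosDegreesBy 0 es ↔ PosDegrees es
  | [] => Iff.rfl
  | _ :: _ => and_congr Iff.rfl posDegreesBy_zero_iff

end Lists

/-! ## §4 The equivalence -/

section Iff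
variable {nn m : ℕ} {src tgt : Fin m → Fin (nn + 1)}

omit L in
/-- ★★ **(3.77) ALONG EVERY ORDERING GIVES KING's SUBGRAPH CONDITION, WITH THE SAME MARGIN**: if `PosDegreesBy γ₁ (kingDegList src tgt dV e π)` for every
ordering `π`, then every non-empty connected sub-line-set `S` has `D(S) > γ₁` — read the ordering that lists `S` first at `i = |S|`.
[cite: King1986, p.664 («every subgraph have positive degree D»), (3.77) p.666] -/
theorem posSubgraphsBy_of_forall_posDegreesBy {γ₁ dV : ℝ} {e : Fin m → ℝ}
    (h : ∀ π : Equiv.Perm (Fin m), PosDegreesBy γ₁ (kingDegList src tgt dV e π)) : PosSubgraphsBy src tgt γ₁ dV e := by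
  intro S hS hc
  have hm : S.card ≤ m := by simpa using S.card_le_univ
  have h1 : 1 ≤ S.card := card_pos.2 hS
  have H := h (prefixPerm S)
  rw [kingDegList_eq_ofFn] at H
  have hlt := posDegreesBy_ofFn_rev_imp_prefix γ₁
    (fun q : Fin m => e (prefixPerm S q) + if IsTreePos src tgt (prefixPerm S) q then dV else 0) H h1 hm
  rw [kingDegList_prefix_eq_prefixDeg, prefixDeg_eq_subDeg_of_connected dV e (prefixLines_prefixPerm S) hS hc] at hlt
  exact hlt

omit L in
/-- ★★★ **KING's TWO SENTENCES ARE EQUIVALENT** (`γ₁ ≥ 0`): «every (non-empty connected) subgraph has degree `> γ₁`» ⟺ «along every ordering every `D(H_i)`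
exceeds `γ₁`». [cite: King1986, p.664, (3.77) p.666] -/
theorem posSubgraphsBy_iff_forall_posDegreesBy {γ₁ dV : ℝ} {e : Fin m → ℝ} (hγ₁ : 0 ≤ γ₁) :
    PosSubgraphsBy src tgt γ₁ dV e ↔ ∀ π : Equiv.Perm (Fin m), PosDegreesBy γ₁ (kingDegList src tgt dV e π) :=
  ⟨fun h π => posDegreesBy_kingDegList_of_posSubgraphsBy hγ₁ h π, posSubgraphsBy_of_forall_posDegreesBy⟩

omit L in
/-- ★★ **IN KING's LETTERS**: for `G`∕`∂G` lines in `dd` dimensions, p.664's «every subgraph has positive degree» (`PosSubgraphsBy src tgt 0 dd (lineExp ∘ κ)`) is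
EQUIVALENT to (3.77) VERBATIM along every ordering (`∀ π, PosDegrees (kingDegList src tgt dd (lineExp ∘ κ) π)`). [cite: King1986, p.664, (3.77) p.666] -/
theorem posSubgraphs_zero_iff_forall_posDegrees (dd : ℕ) (κ : Fin m → Option (Fin dd)) :
    PosSubgraphsBy src tgt 0 ((dd : ℕ) : ℝ) (fun ℓ => lineExp dd (κ ℓ))
      ↔ ∀ π : Equiv.Perm (Fin m), PosDegrees (kingDegList src tgt ((dd : ℕ) : ℝ) (fun ℓ => lineExp dd (κ ℓ)) π) := by
  rw [posSubgraphsBy_iff_forall_posDegreesBy le_rfl]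
  exact forall_congr' fun π => posDegreesBy_zero_iff

end Iff

end Summit.QuantumFields.YangMills.BalabanUVNodes.N15KingModelRung.Curved

end
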